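import Summits.QuantumFields.YangMills.Theorems.LuscherReductionTwistedTraceScalingSpectralWeight
import Literature.Analysis.OperatorTheory.SymmetricLipschitzCalculus
import HarnessLib

/-!
# Continuity of the canonical trial exponent `q_D(G) = ⟨D†G, g(D†D) D†G⟩` in the operator `D`
# (covariant programme, brick c4(iii)-weight III: the weight at the moved point `D_{W·U}` versus `D_U`)

Cell `ym-fleet`, crux `TwistedTraceScaling` (stmt-QuantumFields-20203), line «twolattice», stub S-BASE, lane B = COARSE-LOWER(L₁)
(design note `pub/ym-fleet/ym-20203-coarse-s1/LOWER-BLUEPRINT.md` §5–§6).  HONEST FRAMING: finite-dimensional perturbation bookkeeping; a stub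
of a child of the CONDITIONAL reduction route (femto rung R2b1); not a gap, not Clay.

Along a step `V = W·U` the covariant curl moves, `D' = D_{W·U} = D_U + O(τ)`; the trial state at the moved point carries `g(D'†D')`, the
Gaussian model at `U` carries `g(D†D)`.  With Kittaneh's Hilbert–Schmidt–Lipschitz inequality (Literature
`SymmetricLipschitz.abs_inner_sub_le_of_norm_le`) the difference of the exponents is quadratic in `G` with an explicit constant:

* `norm_spectralWeightLin_le` — `‖g(D†D) z‖ ≤ m_g ‖z‖` for `0 ≤ g ≤ m_g`; `spectralWeightLin_isSymmetric`;
* `norm_adjoint_le` — `‖D†G‖ ≤ C‖G‖` from `‖Dw‖ ≤ C‖w‖`; `norm_gram_sub_le` — `‖(D'†D' − D†D) z‖ ≤ C_Δ (C + C') ‖z‖`;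
* ★★ `abs_weightForm_sub_weightForm_le` — for `0 ≤ g ≤ m_g`, `|g s − g t| ≤ L_g|s − t|`, `‖Dw‖ ≤ C‖w‖`, `‖D'w‖ ≤ C'‖w‖`,
  `‖(D' − D)w‖ ≤ C_Δ‖w‖`:
  `|q_{D'}(G) − q_D(G)| ≤ C_Δ (C + C') · (L_g √n C'² + m_g) · ‖G‖²`
  (`n = dim V`; in the programme `C, C' ≤ 10√N`, `C_Δ = O(τ)`, `L_g, m_g = O(β μ_*^{−5/2})`, `‖G‖² = O(σ)`: the exponent moves by `O(β τ σ) = O(β^{−1})`).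

## References
* F. Kittaneh, Proc. AMS 94 (1985) 416–418, Cor. 2. [Kittaneh1985]
* R. A. Horn, C. R. Johnson, *Matrix Analysis* (2nd ed., 2013), Thm 4.1.5, Thm 7.3.2. [HornJohnson2013]
* M. Lüscher, Nucl. Phys. B219 (1983) 233, §3. [Luscher1983]
-/

noncomputable section

open Matrix Real
open scoped RealInnerProductSpace

namespace Summit.QuantumFields.YangMills.Theorems.FemtoTransferGap.TwoLattice.Harm

open Literature.Analysis.OperatorTheory.SymmetricLipschitz

variable {n : Type*} [Fintype n] [DecidableEq n]
variable {W : Type*} [NormedAddCommGroup W] [InnerProductSpace ℝ W] [FiniteDimensional ℝ W]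

/-! ## §1 The pieces -/

/-- `g(D†D)` is a symmetric operator. [cite: HornJohnson2013, Thm 4.1.5] -/
theorem spectralWeightLin_isSymmetric (g : ℝ → ℝ) (D : EuclideanSpace ℝ n →ₗ[ℝ] W) : (spectralWeightLin g D).IsSymmetric := by
  unfold spectralWeightLin spectralWeight
  rw [Matrix.isSymmetric_toEuclideanLin_iff, Matrix.isHermitian_iff_isSelfAdjoint]
  exact cfc_predicate g (gramMatrix D)

omit [DecidableEq n] in
/-- `D†D` is symmetric. [cite: HornJohnson2013, Thm 7.3.2] -/
theorem gram_isSymmetric (D : EuclideanSpace ℝ n →ₗ[ℝ] W) : (D.adjoint ∘ₗ D).IsSymmetric :=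
  (LinearMap.isPositive_adjoint_comp_self D).isSymmetric

/-- `‖g(D†D) z‖ ≤ m_g‖z‖` when `|g| ≤ m_g` on the Gram spectrum (here: `0 ≤ g ≤ m_g` everywhere). [cite: HornJohnson2013, Thm 4.1.5] -/
theorem norm_spectralWeightLin_le {g : ℝ → ℝ} {m : ℝ} (hg0 : ∀ s, 0 ≤ g s) (hgm : ∀ s, g s ≤ m) (D : EuclideanSpace ℝ n →ₗ[ℝ] W)
    (z : EuclideanSpace ℝ n) : ‖spectralWeightLin g D z‖ ≤ m * ‖z‖ := by
  set e := (gramMatrix_isHermitian D).eigenvectorBasis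
  have hm : 0 ≤ m := (hg0 0).trans (hgm 0)
  have hsq : ‖spectralWeightLin g D z‖ ^ 2 ≤ (m * ‖z‖) ^ 2 := by
    rw [← e.sum_sq_inner_right (spectralWeightLin g D z), mul_pow, ← e.sum_sq_inner_right z, Finset.mul_sum]
    refine Finset.sum_le_sum fun i _ => ?_
    have h : ⟪e i, spectralWeightLin g D z⟫ = g ((gramMatrix_isHermitian D).eigenvalues i) * ⟪e i, z⟫ := by
      rw [← spectralWeightLin_isSymmetric g D (e i) z, spectralWeightLin_apply_eigenvectorBasis, inner_smul_left]; rfl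
    rw [h, mul_pow]
    exact mul_le_mul_of_nonneg_right (pow_le_pow_left₀ (hg0 _) (hgm _) 2) (sq_nonneg _)
  exact (pow_le_pow_iff_left₀ (norm_nonneg _) (by positivity) two_ne_zero).mp hsq

omit [DecidableEq n] in
/-- The adjoint inherits the bound: `‖Dw‖ ≤ C‖w‖ ∀w ⇒ ‖D†G‖ ≤ C‖G‖`. [folklore] -/
theorem norm_adjoint_le {D : EuclideanSpace ℝ n →ₗ[ℝ] W} {C : ℝ} (hC : 0 ≤ C) (hD : ∀ w, ‖D w‖ ≤ C * ‖w‖) (G : W) :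
    ‖D.adjoint G‖ ≤ C * ‖G‖ := by
  set a := D.adjoint G
  have h1 : ‖a‖ ^ 2 = ⟪G, D a⟫ := by rw [← LinearMap.adjoint_inner_left, real_inner_self_eq_norm_sq]
  have h2 : ‖a‖ ^ 2 ≤ ‖G‖ * (C * ‖a‖) := by
    rw [h1]; exact (real_inner_le_norm _ _).trans (mul_le_mul_of_nonneg_left (hD a) (norm_nonneg _))
  by_cases ha : ‖a‖ = 0
  · rw [ha]; positivity
  · have hapos : 0 < ‖a‖ := lt_of_le_of_ne (norm_nonneg _) (Ne.symm ha)
    nlinarith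

omit [DecidableEq n] in
/-- The Gram operators differ by `‖(D'†D' − D†D) z‖ ≤ C_Δ (C + C') ‖z‖`. [folklore] -/
theorem norm_gram_sub_le {D D' : EuclideanSpace ℝ n →ₗ[ℝ] W} {C C' CΔ : ℝ} (hC' : 0 ≤ C') (hCΔ : 0 ≤ CΔ)
    (hD : ∀ w, ‖D w‖ ≤ C * ‖w‖) (hD' : ∀ w, ‖D' w‖ ≤ C' * ‖w‖) (hΔ : ∀ w, ‖(D' - D) w‖ ≤ CΔ * ‖w‖) (z : EuclideanSpace ℝ n) :
    ‖(D'.adjoint ∘ₗ D' - D.adjoint ∘ₗ D) z‖ ≤ CΔ * (C + C') * ‖z‖ := by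
  -- `D'†D' − D†D = D'†(D' − D) + (D' − D)†D`
  have hsplit : (D'.adjoint ∘ₗ D' - D.adjoint ∘ₗ D) z = D'.adjoint ((D' - D) z) + (D' - D).adjoint (D z) := by
    simp only [LinearMap.sub_apply, LinearMap.comp_apply, map_sub]
    abel
  rw [hsplit]
  have h1 : ‖D'.adjoint ((D' - D) z)‖ ≤ C' * (CΔ * ‖z‖) := (norm_adjoint_le hC' hD' _).trans (mul_le_mul_of_nonneg_left (hΔ z) hC')
  have h2 : ‖(D' - D).adjoint (D z)‖ ≤ CΔ * (C * ‖z‖) := (norm_adjoint_le hCΔ hΔ _).trans (mul_le_mul_of_nonneg_left (hD z) hCΔ)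
  calc _ ≤ ‖D'.adjoint ((D' - D) z)‖ + ‖(D' - D).adjoint (D z)‖ := norm_add_le _ _
    _ ≤ C' * (CΔ * ‖z‖) + CΔ * (C * ‖z‖) := add_le_add h1 h2
    _ = CΔ * (C + C') * ‖z‖ := by ring

/-! ## §2 The continuity estimate -/

/-- ★★ **CONTINUITY OF THE TRIAL EXPONENT IN `D`.**  Let `0 ≤ g ≤ m_g`, `|g s − g t| ≤ L_g|s − t|` (`L_g ≥ 0`), and `D, D' : ℝⁿ → W` with
`‖Dw‖ ≤ C‖w‖`, `‖D'w‖ ≤ C'‖w‖`, `‖(D' − D)w‖ ≤ C_Δ‖w‖`.  Then for every `G`,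
`|q_{D'}(G) − q_D(G)| ≤ C_Δ (C + C') (L_g √n C'² + m_g) ‖G‖²`. [cite: Kittaneh1985, Cor. 2] [cite: Luscher1983, §3] -/
theorem abs_weightForm_sub_weightForm_le {g : ℝ → ℝ} {m L : ℝ} (hg0 : ∀ s, 0 ≤ g s) (hgm : ∀ s, g s ≤ m) (hL : 0 ≤ L)
    (hLip : ∀ s t, |g s - g t| ≤ L * |s - t|) {D D' : EuclideanSpace ℝ n →ₗ[ℝ] W} {C C' CΔ : ℝ} (hC : 0 ≤ C) (hC' : 0 ≤ C')
    (hCΔ : 0 ≤ CΔ) (hD : ∀ w, ‖D w‖ ≤ C * ‖w‖) (hD' : ∀ w, ‖D' w‖ ≤ C' * ‖w‖) (hΔ : ∀ w, ‖(D' - D) w‖ ≤ CΔ * ‖w‖) (G : W) :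
    |weightForm g D' G - weightForm g D G| ≤
      CΔ * (C + C') * (L * Real.sqrt (Fintype.card n) * C' ^ 2 + m) * ‖G‖ ^ 2 := by
  have hm : 0 ≤ m := (hg0 0).trans (hgm 0)
  set a := D.adjoint G with ha
  set a' := D'.adjoint G with ha'
  set N := spectralWeightLin g D
  set N' := spectralWeightLin g D'
  -- the split `q' − q = ⟨a', (N' − N) a'⟩ + ⟨a' − a, N (a' + a)⟩`
  have hNs : N.IsSymmetric := spectralWeightLin_isSymmetric g D
  have hsym : ⟪a, N a'⟫ = ⟪a', N a⟫ := by rw [← hNs a a']; exact real_inner_comm a' (N a)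
  have hsplit : weightForm g D' G - weightForm g D G = ⟪a', (N' - N) a'⟫ + ⟪a' - a, N (a' + a)⟫ := by
    unfold weightForm
    rw [← ha, ← ha']
    simp only [LinearMap.sub_apply, map_add, inner_sub_right, inner_add_right, inner_sub_left]
    rw [hsym]
    ring
  -- term 1: Kittaneh
  have hδ : ∀ z, ‖(D'.adjoint ∘ₗ D' - D.adjoint ∘ₗ D) z‖ ≤ CΔ * (C + C') * ‖z‖ := norm_gram_sub_le hC' hCΔ hD hD' hΔ
  have hT' : ∀ i, (D'.adjoint ∘ₗ D') ((gramMatrix_isHermitian D').eigenvectorBasis i) =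
      (gramMatrix_isHermitian D').eigenvalues i • (gramMatrix_isHermitian D').eigenvectorBasis i := fun i => gram_frame D' i
  have hT : ∀ j, (D.adjoint ∘ₗ D) ((gramMatrix_isHermitian D).eigenvectorBasis j) =
      (gramMatrix_isHermitian D).eigenvalues j • (gramMatrix_isHermitian D).eigenvectorBasis j := fun j => gram_frame D j
  have h1 : |⟪a', (N' - N) a'⟫| ≤ L * (Real.sqrt (Fintype.card n) * (CΔ * (C + C'))) * ‖a'‖ * ‖a'‖ :=
    abs_inner_sub_le_of_norm_le (gram_isSymmetric D') (spectralWeightLin_isSymmetric g D') hT' hT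
      (spectralWeightLin_apply_eigenvectorBasis g D') (spectralWeightLin_apply_eigenvectorBasis g D) hL hLip (by positivity) hδ a' a'
  -- term 2
  have ha'a : ‖a' - a‖ ≤ CΔ * ‖G‖ := by
    have : a' - a = (D' - D).adjoint G := by rw [map_sub, LinearMap.sub_apply]
    rw [this]; exact norm_adjoint_le hCΔ hΔ G
  have ha'n : ‖a'‖ ≤ C' * ‖G‖ := norm_adjoint_le hC' hD' G
  have han : ‖a‖ ≤ C * ‖G‖ := norm_adjoint_le hC hD G
  have h2 : |⟪a' - a, N (a' + a)⟫| ≤ CΔ * ‖G‖ * (m * ((C' + C) * ‖G‖)) := by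
    refine (abs_real_inner_le_norm _ _).trans (mul_le_mul ha'a ?_ (norm_nonneg _) (by positivity))
    refine (norm_spectralWeightLin_le hg0 hgm D _).trans (mul_le_mul_of_nonneg_left ?_ hm)
    exact (norm_add_le _ _).trans (by linarith)
  -- assemble
  rw [hsplit]
  have hK : 0 ≤ L * (Real.sqrt (Fintype.card n) * (CΔ * (C + C'))) := by positivity
  have h1' : |⟪a', (N' - N) a'⟫| ≤ L * (Real.sqrt (Fintype.card n) * (CΔ * (C + C'))) * ((C' * ‖G‖) * (C' * ‖G‖)) := by
    refine h1.trans ?_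
    rw [mul_assoc _ ‖a'‖ ‖a'‖]
    exact mul_le_mul_of_nonneg_left (mul_le_mul ha'n ha'n (norm_nonneg _) (by positivity)) hK
  calc |⟪a', (N' - N) a'⟫ + ⟪a' - a, N (a' + a)⟫| ≤ |⟪a', (N' - N) a'⟫| + |⟪a' - a, N (a' + a)⟫| := abs_add_le _ _
    _ ≤ L * (Real.sqrt (Fintype.card n) * (CΔ * (C + C'))) * ((C' * ‖G‖) * (C' * ‖G‖)) + CΔ * ‖G‖ * (m * ((C' + C) * ‖G‖)) :=
        add_le_add h1' h2
    _ = CΔ * (C + C') * (L * Real.sqrt (Fintype.card n) * C' ^ 2 + m) * ‖G‖ ^ 2 := by ring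

end Summit.QuantumFields.YangMills.Theorems.FemtoTransferGap.TwoLattice.Harm

end
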